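import Summits.NavierStokesRegularity.NavierStokesRegularity.Theorems.TypeICertificateLadderTargetRssCompactness
import Summits.NavierStokesRegularity.NavierStokesRegularity.Theorems.TypeICertificateLadderTargetRssStratumForwardUniqueCyl
import Summits.NavierStokesRegularity.NavierStokesRegularity.Theorems.TypeICertificateLadderTargetRssStratumScrew
import Literature.Analysis.FluidPDE.IsometryInvariance
import Literature.Analysis.FluidPDE.ClassicalSolutionRescale
import HarnessLib

/-!
# Crux `Target` (stmt-NavierStokesRegularity-1217), line `killing-twisted-bernoulli-solitons`,
  stub B5b `stub_windowLiouville`: the HELICAL STRATUM — screw-symmetric Type-I rotating solitons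
  do not exist

Support file (theorems only, `--supports stmt-NavierStokesRegularity-1217`), registered sub-goal
`rssStratum_helical` of the c2 lead.

**Theorem (`rssStratum_helical`).** Let `(u, p)` be a classical Navier–Stokes solution on
`ℝ³ × [−1, 0)` with the Type-I bound `‖u(t,x)‖ ≤ C₀/(‖x‖ + √−t)` which is rotated self-similar
with speed `α` (any `α`, including Leray's `α = 0`) and a `C²` profile `U`. If `U` is equivariant
under a SCREW MOTION about the axis with non-zero pitch, `U(R_ψ y + h e₃) = R_ψ U(y)` with `h ≠ 0`
(helical symmetry), then `U = 0`.

Proof (the symmetry–uniqueness trick of `TypeICertificateLadderTargetRssStratumMirror.lean`, with a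
rigid motion that does NOT preserve the Type-I bound). The screw conjugate
`ũ(t,x) = R_ψ u(t, R_{−ψ}(x − h e₃))` of the backward extension of `u` is again a classical solution
on `t < 0` (rotation and translation covariance); it is bounded on `t ≤ −1/2` and, since rigid
motions about the axis preserve the distance to the axis, keeps the cylindrical bound
`r‖ũ‖ ≤ C₀`; and it has the SAME slice `U` at `t = −1` (screw symmetry). By forward uniqueness under
cylindrical bounds (`rssStratum_forward_unique_cyl`: KNSS 2009 Thm. 6.1 mildness + uniqueness of
bounded solutions of the Oseen integral equation) `u = ũ` on `(−1, −1/2)`; comparing the two at time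
`t` shows that the rotated profile is screw-symmetric with the SECOND pitch `h/√−t`, hence
translation invariant along the axis by `h(1 − 1/√−t)`, an interval of lengths, hence by all
lengths (`rssStratum_transl_of_screw`); the decay `‖U(y)‖ ≤ C₀/(1+‖y‖)` then forces `U = 0`.

(Helically symmetric Navier–Stokes flows are classically globally regular — Mahalov–Titi–Leibovich,
ARMA 112 (1990); the present statement is the Type-I-soliton shadow of that, obtained by symmetry
and uniqueness alone.)

## References

* B. Pineau, V. Vicol, arXiv:2607.09619 (2026): Conj. 1.1, §1.2 (1.6)–(1.10). [PineauVicol2026]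
* G. Koch, N. Nadirashvili, G. Seregin, V. Šverák, Acta Math. 203 (2009), Thm. 6.1 (mildness).
  [KochNadirashviliSereginSverak2009]
* A. Majda, A. Bertozzi, *Vorticity and incompressible flow* (CUP 2002), §1.2 Prop. 1.1
  (symmetry covariance). [MajdaBertozziCUP2002]
-/

noncomputable section

namespace Summit.NavierStokesRegularity.NavierStokesRegularity.Theorems

open MeasureTheory Set Function Filter Metric Real
open scoped Topology ContDiff
open Literature.Analysis.FluidPDE Literature.Analysis.FluidPDE.PineauVicol2026

/-! ### Rigid motions about the axis preserve the distance to the axis -/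

/-- The distance to the axis is at most the norm. [folklore] -/
private theorem helical_cylRadius_le_norm (x : EuclideanSpace ℝ (Fin 3)) : cylRadius x ≤ ‖x‖ := by
  rw [cylRadius, EuclideanSpace.norm_eq]
  refine Real.sqrt_le_sqrt ?_
  simp only [Fin.sum_univ_three, Real.norm_eq_abs, sq_abs]
  nlinarith [sq_nonneg (x 2)]

/-- Translations along the axis preserve the distance to the axis. [folklore] -/
private theorem helical_cylRadius_sub_smul (x : EuclideanSpace ℝ (Fin 3)) (c : ℝ) :
    cylRadius (x - c • EuclideanSpace.single 2 (1 : ℝ)) = cylRadius x := by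
  simp [cylRadius]

/-- `R_ψ (R_{−ψ} z) = z`. [folklore] -/
private theorem helical_rotZ_rotZ_neg (ψ : ℝ) (z : EuclideanSpace ℝ (Fin 3)) :
    rotZ ψ (rotZ (-ψ) z) = z := by
  rw [← rotZ_add, add_neg_cancel, rotZ_zero]

/-! ### The registered sub-goal -/

/-- **THE HELICAL STRATUM (registered sub-goal `rssStratum_helical`).** A Type-I rotated
self-similar classical solution of Pineau–Vicol's class (any speed `α`) whose profile is equivariant
under a screw motion about the axis with non-zero pitch, `U(R_ψ y + h e₃) = R_ψ U(y)`, `h ≠ 0`, is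
trivial: `U = 0`. New relative to the source. [cite: PineauVicol2026, Conj. 1.1 and §1.2; KochNadirashviliSereginSverak2009, Thm. 6.1] -/
theorem rssStratum_helical :
    ∀ (C₀ α ψ h : ℝ), h ≠ 0 → ∀ (u : ℝ → EuclideanSpace ℝ (Fin 3) → EuclideanSpace ℝ (Fin 3)) (p : ℝ → EuclideanSpace ℝ (Fin 3) → ℝ) (U : EuclideanSpace ℝ (Fin 3) → EuclideanSpace ℝ (Fin 3)), Literature.Analysis.FluidPDE.IsClassicalNSSolutionOn (Set.Ico (-1) 0) 1 0 u p → (∀ t ∈ Set.Ico (-1 : ℝ) 0, ∀ x : EuclideanSpace ℝ (Fin 3), ‖u t x‖ ≤ C₀ / (‖x‖ + Real.sqrt (-t))) → ContDiff ℝ 2 U → (∀ t ∈ Set.Ico (-1 : ℝ) 0, ∀ x : EuclideanSpace ℝ (Fin 3), u t x = Literature.Analysis.FluidPDE.pvAnsatz α (fun y _ => U y) t x) → (∀ y : EuclideanSpace ℝ (Fin 3), U (Literature.Analysis.FluidPDE.rotZ ψ y + h • EuclideanSpace.single 2 (1 : ℝ)) = Literature.Analysis.FluidPDE.rotZ ψ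 (U y)) → U = 0 := by
  intro C₀ α ψ h hh u p U hsol hI _hU2 hans hscrew
  set e : EuclideanSpace ℝ (Fin 3) := EuclideanSpace.single 2 (1 : ℝ) with he
  -- non-negativity of the constant and the profile bound
  have hC₀ : 0 ≤ C₀ := by
    have h0 := hI (-1) ⟨le_rfl, by norm_num⟩ 0
    rw [norm_zero, zero_add, neg_neg, Real.sqrt_one, div_one] at h0
    exact (norm_nonneg _).trans h0
  have hUb : ∀ y : EuclideanSpace ℝ (Fin 3), ‖U y‖ ≤ C₀ / (‖y‖ + 1) := fun y =>
    profile_bound_of_typeI hI hans y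
  -- backward extension `w` of `u`, classical on `t < 0`, Type-I with constant `C₀`
  obtain ⟨⟨P, hP⟩, hIw⟩ := rssCompact_extend hsol hI hans
  set w : ℝ → EuclideanSpace ℝ (Fin 3) → EuclideanSpace ℝ (Fin 3) :=
    pvAnsatz α (fun y _ => U y) with hw
  -- the screw conjugate `ũ(t,x) = R_ψ w(t, R_{-ψ}(x - h e))`, classical on `t < 0`
  set R : EuclideanSpace ℝ (Fin 3) ≃ₗᵢ[ℝ] EuclideanSpace ℝ (Fin 3) := rotZLIE ψ with hR
  set v : ℝ → EuclideanSpace ℝ (Fin 3) → EuclideanSpace ℝ (Fin 3) :=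
    fun t x => rotZ ψ (w t (rotZ (-ψ) (x - h • e))) with hv
  have hQ : ∃ Q : ℝ → EuclideanSpace ℝ (Fin 3) → ℝ, IsClassicalNSSolutionOn (Iio 0) 1 0 v Q := by
    have h1 := hP.conj_linearIsometryEquiv (R := R) isOpen_Iio.uniqueDiffOn
    have h2 := h1.spaceTranslate (-(h • e))
    refine ⟨fun t x => P t (R.symm (-(h • e) + x)), ?_⟩
    have hf : (fun t x => (fun t x => R ((0 : ℝ → EuclideanSpace ℝ (Fin 3) → EuclideanSpace ℝ (Fin 3)) t
        (R.symm x))) t (-(h • e) + x)) = 0 := by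
      funext t x; simp
    have hvel : (fun t x => (fun t x => R (w t (R.symm x))) t (-(h • e) + x)) = v := by
      funext t x
      simp only [hv, hR, rotZLIE_apply, rotZLIE_symm_apply, neg_add_eq_sub]
    rw [hf, hvel] at h2
    exact h2
  obtain ⟨Q, hQ⟩ := hQ
  -- bounds on the window `(-2, -1/2]`
  have hwb : ∀ t ∈ Ioc (-2 : ℝ) (-(1 / 2)), ∀ y : EuclideanSpace ℝ (Fin 3), ‖w t y‖ ≤ 2 * C₀ := by
    intro t ht y
    have ht0 : t < 0 := by linarith [ht.2]
    refine (hIw t ht0 y).trans ?_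
    have h12 : (1 / 2 : ℝ) ≤ √(-t) := (Real.le_sqrt' (by norm_num)).2 (by nlinarith [ht.2])
    have hden : (1 / 2 : ℝ) ≤ ‖y‖ + √(-t) := by linarith [norm_nonneg y]
    calc C₀ / (‖y‖ + √(-t)) ≤ C₀ / (1 / 2) := div_le_div_of_nonneg_left hC₀ (by norm_num) hden
      _ = 2 * C₀ := by ring
  have hwc : ∀ t ∈ Ioc (-2 : ℝ) (-(1 / 2)), ∀ y : EuclideanSpace ℝ (Fin 3),
      cylRadius y * ‖w t y‖ ≤ C₀ := by
    intro t ht y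
    have ht0 : t < 0 := by linarith [ht.2]
    have hs : 0 < √(-t) := Real.sqrt_pos.2 (by linarith)
    have h1 := hIw t ht0 y
    calc cylRadius y * ‖w t y‖ ≤ ‖y‖ * (C₀ / (‖y‖ + √(-t))) :=
          mul_le_mul (helical_cylRadius_le_norm y) h1 (norm_nonneg _) (norm_nonneg _)
      _ ≤ C₀ := by
          rw [mul_div_assoc']
          rw [div_le_iff₀ (by positivity)]
          nlinarith [norm_nonneg y]
  have hL : ∃ L : ℝ, ∀ t ∈ Ioc (-2 : ℝ) (-(1 / 2)), ∀ x : EuclideanSpace ℝ (Fin 3),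
      ‖w t x‖ ≤ L ∧ ‖v t x‖ ≤ L :=
    ⟨2 * C₀, fun t ht x => ⟨hwb t ht x, by
      simp only [hv, norm_rotZ]; exact hwb t ht _⟩⟩
  have hD : ∃ D : ℝ, ∀ t ∈ Ioc (-2 : ℝ) (-(1 / 2)), ∀ x : EuclideanSpace ℝ (Fin 3),
      cylRadius x * ‖w t x‖ ≤ D ∧ cylRadius x * ‖v t x‖ ≤ D := by
    refine ⟨C₀, fun t ht x => ⟨hwc t ht x, ?_⟩⟩
    simp only [hv, norm_rotZ]
    have hr : cylRadius x = cylRadius (rotZ (-ψ) (x - h • e)) := by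
      rw [cylRadius_rotZ, he, helical_cylRadius_sub_smul]
    rw [hr]
    exact hwc t ht _
  -- the same slice at `t = -1` (screw symmetry)
  have hslice : w (-1) = v (-1) := by
    funext x
    simp only [hv, hw, pvAnsatz_neg_one]
    have key := hscrew (rotZ (-ψ) (x - h • e))
    rw [helical_rotZ_rotZ_neg, sub_add_cancel] at key
    exact key
  -- forward uniqueness, then the algebra of two pitches, then decay
  have heq := rssStratum_forward_unique_cyl w v P Q hP hQ hL hD hslice
  have htrans : ∀ (τ : ℝ) (y : EuclideanSpace ℝ (Fin 3)), U (y + τ • e) = U y :=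
    rssStratum_transl_of_screw α ψ h U hh hscrew fun t ht x => by
      have h1 := congr_fun (heq t ht) x
      simpa only [hv, hw] using h1
  -- decay along the axis kills a translation-invariant profile
  have he1 : ‖e‖ = 1 := by
    rw [he, EuclideanSpace.norm_eq]
    simp
  funext y
  rw [Pi.zero_apply]
  by_contra hy
  have hpos : 0 < ‖U y‖ := norm_pos_iff.2 hy
  obtain ⟨n, hn⟩ := exists_nat_gt (C₀ / ‖U y‖ + ‖y‖)
  have hshift := htrans (n : ℝ) y
  have hbound := hUb (y + (n : ℝ) • e)
  rw [hshift] at hbound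
  -- `‖y + n e‖ ≥ n - ‖y‖`
  have hge : (n : ℝ) - ‖y‖ ≤ ‖y + (n : ℝ) • e‖ := by
    have h1 : ‖(n : ℝ) • e‖ = n := by
      rw [norm_smul, he1, mul_one, Real.norm_of_nonneg (Nat.cast_nonneg n)]
    have h2 := norm_sub_norm_le ((n : ℝ) • e) (-y)
    rw [norm_neg, h1, sub_neg_eq_add, add_comm ((n : ℝ) • e) y] at h2
    linarith [abs_le.1 (abs_norm_sub_norm_le ((n : ℝ) • e) (-y))]
  have hden : C₀ / ‖U y‖ < ‖y + (n : ℝ) • e‖ + 1 := by linarith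
  have hden0 : 0 < ‖y + (n : ℝ) • e‖ + 1 := by positivity
  have : C₀ / (‖y + (n : ℝ) • e‖ + 1) < ‖U y‖ := by
    rw [div_lt_iff₀ hden0]
    have := (div_lt_iff₀ hpos).1 hden
    linarith
  linarith

end Summit.NavierStokesRegularity.NavierStokesRegularity.Theorems

end
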